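import Summits.CriticalPhenomena.Ising3DConformalLimit.Theorems.SubPtolemyFloor.Negative.ExponentWindow

/-!
# `SubPtolemyFloor` (item stmt-CriticalPhenomena-15703): what a refutation must assert, given an exponent or a limit

Negative / structural knowledge about the crux
`Summit.CriticalPhenomena.Ising3DConformalLimit.Theses.SubPtolemyInterlacing.SubPtolemyFloor` (route
SubPtolemyInterlacing, r3), from its standing crux disprover (D-0016); THEOREM-ONLY, no new definitions.
Companion of `ExponentWindow.lean` (unconditional window `1 ≤ a < log₂(1+√2)`).

* `exponent_le_of_floor` — abstract core: a floor `c·n^{-a} ≤ g(n)` (`n ≥ 1`, `c > 0`) forces the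
  log-exponent `L` of `g` (`log g(n)/log n → -L`) to satisfy `L ≤ a`.
* `exponent_lt_threshold_of_crux` / `not_crux_of_threshold_le_exponent` — if the axial exponent `L` of
  `⟨σ₀σ_{n e₁}⟩_{β_c(3)}` exists, r3 forces `L < log₂(1+√2)`; an exponent `L ≥ log₂(1+√2)` REFUTES r3.
* `two_mul_dim_lt_threshold_of_crux` / `not_crux_of_limit_of_threshold_le` — for every non-degenerate
  pointwise scaling limit with scaling dimension `Δ` (the data of the route's `MoebiusLimit`), r3 forces
  `2Δ < log₂(1+√2)`, and a limit with `2Δ ≥ log₂(1+√2)` (`Δ ≥ 0.6358`) REFUTES r3. With the tree's window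
  `Δ ∈ [1/2, 3/4]` (`exists_rpow_scale_mem_Icc_threeQuarters`, DCP 2025 Thm 1.5) a disproof through a limit
  is the assertion `Δ_σ(3) ∈ [0.6358, 0.75]` (`exists_eta_of_limit_of_not_crux`: `η(3) ∈ [0.2716, 0.5]`
  would exist) — against `Δ_σ = 0.5181489(10)` (bootstrap) nothing rigorous points there.
* `threshold_lt_three_halves`, `five_fourths_lt_threshold` — `5/4 < log₂(1+√2) < 3/2`: the conditional
  DCP bound `2Δ ≤ 3/2` does not reach the threshold; one-sided `η(3) < 1/4 = η(2)` would.
* `not_floor_modelProfile` — the profile `n^{-3/2}` satisfies every axial two-point constraint the tree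
  knows at `β_c(3)` (`modelProfile_window`: `n^{-2} ≤ p ≤ n^{-1}`; `modelProfile_anti`; exponent `3/2`,
  `modelProfile_hasDecayExponent`) and violates the floor: two-point axiomatics cannot prove r3.
-/

noncomputable section

namespace Summit.CriticalPhenomena.Ising3DConformalLimit.SubPtolemyFloorNegative

open Literature.Probability.LatticeModels Filter Set
open Summit.CriticalPhenomena.Ising3DConformalLimit.Theses
open scoped Topology

/-! ### The threshold against the rigorous conditional window: `5/4 < log₂(1+√2) < 3/2` -/

/-- `log₂(1+√2) < 3/2` (`1 + √2 < 2√2`). [folklore] -/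
theorem threshold_lt_three_halves : Real.logb 2 (1 + Real.sqrt 2) < 3 / 2 := by
  rw [Real.logb_lt_iff_lt_rpow one_lt_two (by positivity)]
  have h2 : (2 : ℝ) ^ ((3 : ℝ) / 2) = 2 * Real.sqrt 2 := by
    rw [show ((3 : ℝ) / 2) = 1 + 1 / 2 by norm_num, Real.rpow_add two_pos, Real.rpow_one,
      Real.sqrt_eq_rpow]
  rw [h2]
  have h : (1 : ℝ) < Real.sqrt 2 := by
    rw [Real.lt_sqrt zero_le_one]; norm_num
  linarith

/-- `5/4 < log₂(1+√2)` (`32 < (1+√2)^4 = 17 + 12√2`). [folklore] -/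
theorem five_fourths_lt_threshold : (5 / 4 : ℝ) < Real.logb 2 (1 + Real.sqrt 2) := by
  rw [Real.lt_logb_iff_rpow_lt one_lt_two (by positivity)]
  have hs : Real.sqrt 2 ^ 2 = 2 := Real.sq_sqrt (by norm_num)
  have h54 : (5 / 4 : ℝ) < Real.sqrt 2 := by
    rw [Real.lt_sqrt (by norm_num)]; norm_num
  have hpow : ((2 : ℝ) ^ ((5 : ℝ) / 4)) ^ (4 : ℕ) = 32 := by
    rw [← Real.rpow_mul_natCast (by norm_num)]
    norm_num
  have h4 : (32 : ℝ) < (1 + Real.sqrt 2) ^ (4 : ℕ) := by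
    have hs4 : Real.sqrt 2 ^ 4 = 4 := by nlinarith [hs]
    have hs3 : Real.sqrt 2 ^ 3 = 2 * Real.sqrt 2 := by nlinarith [hs]
    nlinarith [hs, hs3, hs4, h54]
  refine lt_of_pow_lt_pow_left₀ 4 (by positivity) ?_
  rw [hpow]
  exact h4

/-! ### A floor bounds the log-exponent -/

/-- **Abstract core.** If `c·n^{-a} ≤ g(n)` for all `n ≥ 1` (`c > 0`) and `log g(n)/log n → -L`, then
`L ≤ a`. [folklore] -/
theorem exponent_le_of_floor {g : ℕ → ℝ} {L a c : ℝ} (hc : 0 < c)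
    (h : ∀ n : ℕ, 1 ≤ n → c * (n : ℝ) ^ (-a) ≤ g n) (hL : HasDecayExponent g L) : L ≤ a := by
  have hlow : ∀ᶠ n : ℕ in atTop, Real.log c / Real.log n - a ≤ Real.log (g n) / Real.log n := by
    filter_upwards [eventually_ge_atTop 2] with n hn
    have hn0 : (0 : ℝ) < n := by exact_mod_cast (by omega : 0 < n)
    have hlogn : 0 < Real.log n := Real.log_pos (by exact_mod_cast (by omega : 1 < n))
    have hpow : 0 < (n : ℝ) ^ (-a) := Real.rpow_pos_of_pos hn0 _
    have hgn : c * (n : ℝ) ^ (-a) ≤ g n := h n (by omega)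
    have hlog : Real.log c + (-a) * Real.log n ≤ Real.log (g n) := by
      rw [← Real.log_rpow hn0, ← Real.log_mul hc.ne' hpow.ne']
      exact Real.log_le_log (mul_pos hc hpow) hgn
    have e : Real.log c / Real.log n - a = (Real.log c + (-a) * Real.log n) / Real.log n := by
      field_simp
      ring
    rw [e, div_le_div_iff_of_pos_right hlogn]
    exact hlog
  have hlim : Tendsto (fun n : ℕ => Real.log c / Real.log n - a) atTop (𝓝 (0 - a)) :=
    (tendsto_const_nhds.div_atTop (Real.tendsto_log_atTop.comp tendsto_natCast_atTop_atTop)).sub_const a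
  have := le_of_tendsto_of_tendsto hlim hL hlow
  linarith

/-! ### Given the axial exponent -/

/-- **r3 forces the axial exponent below the threshold**: if `log ⟨σ₀σ_{n e₁}⟩_{β_c(3)} / log n → -L`
and r3 holds, then `L < log₂(1+√2)`. [folklore] -/
theorem exponent_lt_threshold_of_crux {L : ℝ}
    (hL : HasDecayExponent (fun m : ℕ => criticalTwoPoint 3 (Pi.single 0 (m : ℤ))) L)
    (h : SubPtolemyInterlacing.SubPtolemyFloor) : L < Real.logb 2 (1 + Real.sqrt 2) := by
  obtain ⟨a, c, ha, hc, hf⟩ := h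
  refine (exponent_le_of_floor hc (fun n hn => ?_) hL).trans_lt ha
  have := hf n hn
  rwa [zsmul_single_zero_one] at this

/-- **An axial exponent `L ≥ log₂(1+√2)` refutes r3.** [folklore] -/
theorem not_crux_of_threshold_le_exponent {L : ℝ}
    (hL : HasDecayExponent (fun m : ℕ => criticalTwoPoint 3 (Pi.single 0 (m : ℤ))) L)
    (hle : Real.logb 2 (1 + Real.sqrt 2) ≤ L) : ¬ SubPtolemyInterlacing.SubPtolemyFloor :=
  fun h => not_le_of_gt (exponent_lt_threshold_of_crux hL h) hle

/-! ### Given a non-degenerate pointwise scaling limit (the data of the route's `MoebiusLimit`) -/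

/-- **r3 forces `2Δ < log₂(1+√2)` for every non-degenerate pointwise limit with ratio index `-Δ`**
(`HasPointwiseScalingLimit.hasDecayExponent_axis`). [cite: MessagerMiracleSoleJSP1977, main theorem (monotonicity of ⟨σ₀σ_x⟩ under reflections)] -/
theorem two_mul_dim_lt_threshold_of_crux_of_ratio {ρ : ℝ → ℝ} {S : CorrFamily 3} {Δ : ℝ}
    (hρ : ∀ δ ∈ Set.Ioc (0:ℝ) 1, 0 < ρ δ) (hlim : HasPointwiseScalingLimit (criticalCorr 3) ρ S)
    (hnd : IsNondegenerateTwoPoint S)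
    (hratio : Tendsto (fun δ => ρ (1/2 * δ) / ρ δ) (𝓝[>] 0) (𝓝 ((1/2:ℝ) ^ (-Δ))))
    (h : SubPtolemyInterlacing.SubPtolemyFloor) : 2 * Δ < Real.logb 2 (1 + Real.sqrt 2) :=
  exponent_lt_threshold_of_crux (hlim.hasDecayExponent_axis hρ hnd hratio) h

/-- **r3 forces `2Δ < log₂(1+√2)` for every non-degenerate `IsScaleCovariant Δ` pointwise limit** (the
covariance exponent of a non-degenerate family is unique; Lamperti ratio clause from the tree). [folklore] -/
theorem two_mul_dim_lt_threshold_of_crux {ρ : ℝ → ℝ} {S : CorrFamily 3} {Δ : ℝ}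
    (hρ : ∀ δ ∈ Set.Ioc (0:ℝ) 1, 0 < ρ δ) (hlim : HasPointwiseScalingLimit (criticalCorr 3) ρ S)
    (hnd : IsNondegenerateTwoPoint S) (hsc : IsScaleCovariant Δ S)
    (h : SubPtolemyInterlacing.SubPtolemyFloor) : 2 * Δ < Real.logb 2 (1 + Real.sqrt 2) := by
  obtain ⟨Δ₂, -, hcov₂, hratio⟩ := hlim.exists_rpow_scale_and_ratio (by norm_num) hρ hnd
  have hx₀ := refPair_mem_nonCoincident (d := 3) (by norm_num)
  set x₀ : Fin 2 → EuclideanSpace ℝ (Fin 3) :=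
    ![0, EuclideanSpace.single (⟨0, by norm_num⟩ : Fin 3) (1:ℝ)] with hx₀def
  have ha : 0 < S 2 x₀ := hnd _ hx₀
  have heq : Δ₂ = Δ := by
    have e₁ := hsc 2 2 two_pos x₀
    have e₂ := hcov₂ 2 2 two_pos x₀ hx₀
    rw [e₁] at e₂
    have h1 := mul_right_cancel₀ ha.ne' e₂
    have hl : 0 < Real.log 2 := Real.log_pos one_lt_two
    have h' := congrArg Real.log h1
    rw [Real.log_rpow two_pos, Real.log_rpow two_pos] at h'
    have h'' := mul_right_cancel₀ hl.ne' h'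
    push_cast at h''
    linarith
  subst heq
  exact two_mul_dim_lt_threshold_of_crux_of_ratio hρ hlim hnd (hratio (1/2) (by norm_num)) h

/-- **The kill recipe through a limit**: a non-degenerate scale-covariant pointwise limit with
`2Δ ≥ log₂(1+√2)` (`Δ ≥ 0.6358`) REFUTES r3. [folklore] -/
theorem not_crux_of_limit_of_threshold_le {ρ : ℝ → ℝ} {S : CorrFamily 3} {Δ : ℝ}
    (hρ : ∀ δ ∈ Set.Ioc (0:ℝ) 1, 0 < ρ δ) (hlim : HasPointwiseScalingLimit (criticalCorr 3) ρ S)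
    (hnd : IsNondegenerateTwoPoint S) (hsc : IsScaleCovariant Δ S)
    (hle : Real.logb 2 (1 + Real.sqrt 2) ≤ 2 * Δ) : ¬ SubPtolemyInterlacing.SubPtolemyFloor :=
  fun h => not_le_of_gt (two_mul_dim_lt_threshold_of_crux hρ hlim hnd hsc h) hle

/-- **What a refutation would assert, granted any non-degenerate limit**: `η(3)` exists and lies in
`[log₂(1+√2) - 1, 1/2] = [0.2716, 0.5]` (tree: `exists_rpow_scale_mem_Icc_threeQuarters`). [cite: DuminilCopinPanis2025LowerBounds, Theorem 1.5] -/
theorem exists_eta_of_limit_of_not_crux {ρ : ℝ → ℝ} {S : CorrFamily 3}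
    (hρ : ∀ δ ∈ Set.Ioc (0:ℝ) 1, 0 < ρ δ) (hlim : HasPointwiseScalingLimit (criticalCorr 3) ρ S)
    (hnd : IsNondegenerateTwoPoint S) (h : ¬ SubPtolemyInterlacing.SubPtolemyFloor) :
    ∃ η ∈ Set.Icc (Real.logb 2 (1 + Real.sqrt 2) - 1) (1/2 : ℝ), HasIsingExponentEta 3 η := by
  obtain ⟨Δ, hΔ, -, hratio, hη⟩ := hlim.exists_rpow_scale_mem_Icc_threeQuarters hρ hnd
  refine ⟨2 * Δ - 1, ⟨?_, by linarith [hΔ.2]⟩, hη⟩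
  by_contra hlt
  rw [not_le] at hlt
  -- `2Δ < log₂(1+√2)`: then the floor holds with any `a ∈ (2Δ, log₂(1+√2))`, contradiction with `h`
  have hL := hlim.hasDecayExponent_axis hρ hnd (hratio (1/2) (by norm_num))
  apply h
  set T := Real.logb 2 (1 + Real.sqrt 2) with hT
  set a : ℝ := max 0 ((2 * Δ + T) / 2) with ha
  have hT1 : 1 < T := one_lt_threshold
  have haT : a < T := max_lt (by linarith) (by linarith)
  have hLa : 2 * Δ < a := lt_of_lt_of_le (by linarith) (le_max_right _ _)
  have ha0 : 0 ≤ a := le_max_left _ _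
  have hev : ∀ᶠ n : ℕ in atTop,
      -a < Real.log (criticalTwoPoint 3 (Pi.single 0 (n : ℤ))) / Real.log n :=
    hL.eventually_const_lt (by linarith)
  obtain ⟨N, hN⟩ := eventually_atTop.1 (hev.and (eventually_ge_atTop 2))
  have hge : ∀ n : ℕ, N ≤ n → (n : ℝ) ^ (-a) ≤ criticalTwoPoint 3 (Pi.single 0 (n : ℤ)) := by
    intro n hn
    obtain ⟨h1, h2⟩ := hN n hn
    have hn0 : (0 : ℝ) < n := by exact_mod_cast (by omega : 0 < n)
    have hlogn : 0 < Real.log n := Real.log_pos (by exact_mod_cast (by omega : 1 < n))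
    have hgpos := criticalTwoPoint_axis_pos n
    rw [lt_div_iff₀ hlogn] at h1
    have h3 : Real.log ((n : ℝ) ^ (-a)) < Real.log (criticalTwoPoint 3 (Pi.single 0 (n : ℤ))) := by
      rw [Real.log_rpow hn0]; exact h1
    exact ((Real.log_lt_log_iff (Real.rpow_pos_of_pos hn0 _) hgpos).1 h3).le
  refine ⟨a, criticalTwoPoint 3 (Pi.single 0 (N : ℤ)), haT, criticalTwoPoint_axis_pos N,
    fun n hn => ?_⟩
  rw [zsmul_single_zero_one]
  have hn0 : (0 : ℝ) < n := by exact_mod_cast hn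
  have hgN1 : criticalTwoPoint 3 (Pi.single 0 (N : ℤ)) ≤ 1 := criticalTwoPoint_le_one' _
  have hgN0 : 0 ≤ criticalTwoPoint 3 (Pi.single 0 (N : ℤ)) := (criticalTwoPoint_axis_pos N).le
  have hpow1 : (n : ℝ) ^ (-a) ≤ 1 :=
    Real.rpow_le_one_of_one_le_of_nonpos (by exact_mod_cast hn) (by linarith)
  have hpow0 : 0 ≤ (n : ℝ) ^ (-a) := Real.rpow_nonneg hn0.le _
  rcases le_or_gt N n with hle | hlt'
  · calc criticalTwoPoint 3 (Pi.single 0 (N : ℤ)) * (n : ℝ) ^ (-a)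
        ≤ 1 * (n : ℝ) ^ (-a) := mul_le_mul_of_nonneg_right hgN1 hpow0
      _ = (n : ℝ) ^ (-a) := one_mul _
      _ ≤ criticalTwoPoint 3 (Pi.single 0 (n : ℤ)) := hge n hle
  · calc criticalTwoPoint 3 (Pi.single 0 (N : ℤ)) * (n : ℝ) ^ (-a)
        ≤ criticalTwoPoint 3 (Pi.single 0 (N : ℤ)) * 1 := mul_le_mul_of_nonneg_left hpow1 hgN0
      _ = criticalTwoPoint 3 (Pi.single 0 (N : ℤ)) := mul_one _
      _ ≤ criticalTwoPoint 3 (Pi.single 0 (n : ℤ)) := criticalTwoPoint_axis_antitone hlt'.le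

/-! ### Two-point axiomatics do not decide r3: the profile `n^{-3/2}` -/

/-- The model profile `p(n) = n^{-3/2}` has log-exponent `3/2`. [folklore] -/
theorem modelProfile_hasDecayExponent :
    HasDecayExponent (fun n : ℕ => (n : ℝ) ^ (-(3/2 : ℝ))) (3/2) := by
  unfold HasDecayExponent
  refine (tendsto_const_nhds (x := (-(3/2 : ℝ)))).congr' ?_
  filter_upwards [eventually_ge_atTop 2] with n hn
  have hn0 : (0 : ℝ) < n := by exact_mod_cast (by omega : 0 < n)
  have hlogn : Real.log n ≠ 0 := (Real.log_pos (by exact_mod_cast (by omega : 1 < n))).ne'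
  rw [Real.log_rpow hn0, mul_div_assoc, div_self hlogn, mul_one]

/-- The model profile lies in the rigorous window `n^{-2} ≤ p(n) ≤ n^{-1}` (Simon–Lieb / infrared shape). [folklore] -/
theorem modelProfile_window {n : ℕ} (hn : 1 ≤ n) :
    (n : ℝ) ^ (-(2 : ℝ)) ≤ (n : ℝ) ^ (-(3/2 : ℝ)) ∧ (n : ℝ) ^ (-(3/2 : ℝ)) ≤ (n : ℝ) ^ (-(1 : ℝ)) := by
  have h1 : (1 : ℝ) ≤ n := by exact_mod_cast hn
  exact ⟨Real.rpow_le_rpow_of_exponent_le h1 (by norm_num),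
    Real.rpow_le_rpow_of_exponent_le h1 (by norm_num)⟩

/-- The model profile is antitone on `n ≥ 1` (Messager–Miracle-Solé shape). [folklore] -/
theorem modelProfile_anti {m n : ℕ} (hm : 1 ≤ m) (hmn : m ≤ n) :
    (n : ℝ) ^ (-(3/2 : ℝ)) ≤ (m : ℝ) ^ (-(3/2 : ℝ)) :=
  Real.rpow_le_rpow_of_nonpos (by exact_mod_cast hm) (by exact_mod_cast hmn) (by norm_num)

/-- **The model profile violates the floor** although it passes every axial two-point test above and the
DCP `3/2`-window: r3 does not follow from two-point axiomatics. [folklore] -/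
theorem not_floor_modelProfile :
    ¬ ∃ a c : ℝ, a < Real.logb 2 (1 + Real.sqrt 2) ∧ 0 < c ∧ ∀ n : ℕ, 1 ≤ n →
        c * (n : ℝ) ^ (-a) ≤ (n : ℝ) ^ (-(3/2 : ℝ)) := by
  rintro ⟨a, c, ha, hc, h⟩
  have hL := exponent_le_of_floor hc h modelProfile_hasDecayExponent
  linarith [threshold_lt_three_halves]

end Summit.CriticalPhenomena.Ising3DConformalLimit.SubPtolemyFloorNegative

end
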